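import Literature.IUT.HodgeTheaters.TemperedCoveringsCor23LevelsSub
import Literature.IUT.HodgeArakelov.LabelClassesOfCuspsCor24iLevelsBridge
import Literature.IUT.HodgeArakelov.LabelClassesOfCuspsCor24iInputsInc
import HarnessLib

/-!
# [IUTchII] Cor 2.4 (i), input (B): ASSEMBLY (sub-DAG row B5) over the [IUTchI] §2 level statements

S. Mochizuki, *Inter-universal Teichmüller Theory II*, kurims manuscript (Dec. 2020), §2, Cor 2.4 (i), proof p.70 l.−2 –
p.71 l.3: "Now, by applying the equivalence of [IUTchI], Corollary 2.3, (vi) [cf. also [CombGC], Proposition 1.2, (ii)], to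
the various finite index open subgroups of `Δ^±_v`, it follows that `γ' ∈ Δ̂^±_{v□}` — where we use the notation "∧" to
denote the closure in `Δ̂^±_v`"; *… I*, kurims manuscript (May 2020), §2, Cor 2.3 (vi) p.48, proof of Prop 2.4 (i) p.50
l.27–42 (the levels `J`) [cite: Mochizuki2012, II Cor 2.4 (i) pp.70-71] (D-0012 claim key, status disputed; PROOF-ONLY —
no definition, nothing of the series asserted; abc-iut cell, seat abc-iut-w5-d121; node `IUTchII:Cor2.4(i)` input (B) =
GAP-LEDGER G-w4d012-2; sub-DAG `plan/L5/SUBDAG-IUTchI-Cor23Levels.md`, row B5 "ASSEMBLY … any L6 seat").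

INPUTS BY NAME.  abc-iut-L5-t11's `TemperedCoveringsCor23LevelsSub` (rows B0–B4-L5) types, over abc-iut-w5-d119's
`Prop24Tower` of levels `Ĵ_i ⊆ Π̂_X` extended by the level-`i` dual-graph data `SubgraphLevelData` (vertices of `𝔾_{J_i}`
with the `Π^tp_X`-action, the components of `p_i⁻¹(ℍ)`, the distinguished `ℍ̃_i`, the vertex of each cusp), the printed
per-level inputs as NAMED predicates: B3 `LevelIncidence` ([IUTchI] Cor 2.3 (vi) (a)⇒(b) at level `i`), the block
property `IsBlock` ([CombGC] Prop 1.2 (ii)-type; ⇐ `CompsDisjoint` + `CompsInvariant`), B1 (c) `StabLeDeltaHLevel`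
(`Stab_{Δ^tp_X}(ℍ̃_i) ⊆ Δ^tp_{X,ℍ}·J_i`), and `LevelsNormal`.  This file:
* § 1 (`Π^tp_X` side): the per-level target in the FINITE-INDEX form the consumer needs — for ANY subgroup `I_D`
  squeezed between the level-`i` inertia group `(t I_x t⁻¹) ∩ J_i` and `Δ^tp_{X,ℍ}`: `γ ∈ Δ^tp_X`, `I_D^γ ⊆ Δ^tp_{X,ℍ}` ⟹
  `γ ∈ Δ^tp_{X,ℍ}·J_i` (`levelTarget_sub_of_inputs`; the printed one-sentence argument exactly as in abc-iut-L5-t11's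
  `levelTarget_of_inputs`, B3 being fed the level-`i` inertia groups with `j = 1`; needed because the node's `I_t` is a
  cuspidal inertia group of `Π_v`, i.e. a FINITE-INDEX subgroup `I' ∩ Π_v` of a cuspidal inertia group `I'` of `Π^±_v` —
  [IUTchII] Def 2.3 (ii), Rmk 2.3.1 "`I ∩ Π_⊆ = I^l`" — not the full `t I_x t⁻¹`: the "[cf. also [CombGC], Proposition
  1.2, (ii)]" of the printed sentence), and its `Π̂_X`-side form `levelTarget_sub_hat`;
* § 2 (`Π̂^cor_v` side): **`StableCurveAgreement.h23vi_of_subgraphLevelData`** — the binder (B) `h23vi` UNDER the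
  printed hypotheses "`I_t` cuspidal in `Π_v`, `I_t ⊆ Δ_{v□}`" (the `…_inc` form of `LabelClassesOfCuspsCor24iInputsInc`),
  from: the B13 agreement `A` with the `Δ`-level `ℍ`-dictionary `Dic` of the target `Π_{v□}` (abc-iut-L6-t7), Def 2.3
  (ii)′ (`Def23_ii'`, abc-iut-L6-t19), the tower + level data with the four named predicates above, the levels'
  shrinking `hbasis'` (abc-iut-L5-t11's `exists_level_subset_of_mem_nhds` ⇐ `DeltaHatClosed`, `LevelsInDelta`,
  `LevelsCofinal`), and the choice of the levels INSIDE `Π̂_v` — "the various finite index open subgroups of `Δ^±_v`":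
  those below the OPEN subgroup `Δ̂_v ⊆ Δ̂^±_v` ([IUTchII] Def 2.3 (i) p.67 "a normal open subgroup of index `l`") are
  cofinal — read on tempered elements through `Π^±_v ∩ Π̂_v = Π_v` (`hlevV`, `hinf`; abc-iut-w5-d132's H25Lift binder
  shape); via abc-iut-w5-d121's `h23vi_of_levelwise` (p414651) and `levels_hbasis_of_piHat` (p417472);
* § 3: **B5** — `cor24_i'_of_levels_of_equiv_zHat` / `cor24_ii_iii'_of_levels_of_equiv_zHat`: the decls of record
  `Cor24_i'`, `Cor24_ii_iii'` from the agreements with (B) SUPPLIED per admissible `Π_{v□'}` by such level data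
  (`LevelsDic`), i.e. node `IUTchII:Cor2.4(i)` modulo NAMED [IUTchI] §2 predicates + dictionaries only.
PROVED (kernel); every [IUTchI]/[IUTchII] statement is a HYPOTHESIS; typed ≠ proved; nothing here bears on
[IUTchIII] Cor 3.12.
-/

universe u

/-! ## § 1. The per-level target for finite-index inertia subgroups (`Π^tp_X` side) -/

namespace Literature.IUT.HodgeTheaters

open scoped Pointwise

namespace StableCurveTemperedData

variable {D : StableCurveTemperedData.{u}}

/-- **IUTchI:Cor2.3(i)** (kurims p.47) The image of `Δ^tp_{X,ℍ} ⊆ Π^tp_X` in `Π̂_X` and the image of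
`Δ^tp_{X,ℍ} ↪ Δ̂_X ⊆ Π̂_X` agree: `y ∈ Δ^tp_{X,ℍ}` iff `ι(y)` lies in the image of `Δ^tp_{X,ℍ}` read through `Δ̂_X`.
PROVED (`ι` injective). [claim: Mochizuki2012, status: disputed] -/
theorem mem_deltaTpH_map_iff (D : StableCurveTemperedData.{u}) (y : D.PiTp) :
    y ∈ D.deltaTpH.map D.DeltaTp.subtype ↔ D.ιX y ∈ (D.deltaTpH.map D.ιΔ).map D.DeltaHat.subtype := by
  constructor
  · rintro ⟨d, hd, rfl⟩
    exact ⟨D.ιΔ d, ⟨d, hd, rfl⟩, rfl⟩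
  · rintro ⟨_, ⟨d, hd, rfl⟩, hdy⟩
    have hdy' : D.ιX (d : D.PiTp) = D.ιX y := hdy
    exact ⟨d, hd, D.ιX_injective hdy'⟩

namespace Prop24Tower

variable (T : D.Prop24Tower)

/-- **IUTchI:Prop2.4(i)** (kurims p.50 l.27 "characteristic") Normal levels `Ĵ_i ∩ Δ̂_X ⊴ Δ̂_X` give normal tempered
levels `J_i = Δ^tp_X ∩ ι⁻¹(Ĵ_i) ⊴ Δ^tp_X`. PROVED. [claim: Mochizuki2012, status: disputed] -/
theorem levelTp_normal (hN : T.LevelsNormal) (i : T.I) : (D.levelTp (T.Jhat i)).Normal := by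
  refine ⟨fun n hn g => ?_⟩
  have hn' : D.ιΔ n ∈ (T.Jhat i).subgroupOf D.DeltaHat := hn
  have := (hN i).conj_mem _ hn' (D.ιΔ g)
  rw [← map_mul, ← map_inv, ← map_mul] at this
  exact this

namespace SubgraphLevelData

variable {T} (L : T.SubgraphLevelData)

/-- **IUTchII:Cor2.4(i)** (kurims p.70 l.−2 – p.71 l.3, ONE level, finite-index form) For a cusp `t·x̃`, a level `i` and
ANY subgroup `I_D ⊆ Π^tp_X` with `(t I_x t⁻¹) ∩ J_i ⊆ I_D ⊆ Δ^tp_{X,ℍ}` (e.g. `I_D = I' ∩ Π_v` for the node's `I_t`, the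
levels being inside `Δ_v`): every `γ ∈ Δ^tp_X` with `I_D^γ ⊆ Δ^tp_{X,ℍ}` lies in `Δ^tp_{X,ℍ} · J_i`.  The printed sentence
at one level: B3 (`LevelIncidence`, fed the level-`i` inertia groups `(t I_x t⁻¹) ∩ J_i` and `(γt I_x (γt)⁻¹) ∩ J_i =
((t I_x t⁻¹) ∩ J_i)^γ`, `J_i` being normal) puts the vertices `t·c` and `γ·(t·c)` in `ℍ̃_i`; `ℍ̃_i` is a block
(`IsBlock`), so `γ` stabilises it; B1 (c) (`StabLeDeltaHLevel`) concludes.  PROVED from the NAMED inputs (hypotheses).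
[claim: Mochizuki2012, status: disputed] -/
theorem levelTarget_sub_of_inputs (hN : T.LevelsNormal) (hinc : L.LevelIncidence) (hblk : L.IsBlock)
    (hstab : L.StabLeDeltaHLevel) (i : T.I) (x : D.Cusp) (t : D.PiTp) (ID : Subgroup D.PiTp)
    (hlev : MulAut.conj t • ((D.inertiaTp x).map D.DeltaTp.subtype) ⊓ (D.levelTp (T.Jhat i)).map D.DeltaTp.subtype
      ≤ ID)
    (hmeet : ID ≤ D.deltaTpH.map D.DeltaTp.subtype) (γ : D.DeltaTp)
    (hc : MulAut.conj (γ : D.PiTp) • ID ≤ D.deltaTpH.map D.DeltaTp.subtype) :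
    ∃ k ∈ D.deltaTpH, k⁻¹ * γ ∈ D.levelTp (T.Jhat i) := by
  haveI := T.levelTp_normal hN i
  -- the `LevelIncidence` hypothesis with `j = 1` for a subgroup `K` whose level-`i` part lies in `Δ^tp_{X,ℍ}`
  have hyp : ∀ K : Subgroup D.PiTp, K ⊓ (D.levelTp (T.Jhat i)).map D.DeltaTp.subtype ≤
      D.deltaTpH.map D.DeltaTp.subtype →
      ∃ j ∈ (D.levelTp (T.Jhat i)).map D.DeltaTp.subtype,
        K ⊓ (D.levelTp (T.Jhat i)).map D.DeltaTp.subtype ≤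
          MulAut.conj j • ((D.deltaTpH ⊓ D.levelTp (T.Jhat i)).map D.DeltaTp.subtype) := by
    intro K hK
    refine ⟨1, one_mem _, ?_⟩
    rw [map_one, one_smul]
    intro y hy
    obtain ⟨j, hj, hjy⟩ := hy.2
    obtain ⟨d, hd, hdy⟩ := hK hy
    have : j = d := Subtype.ext (hjy.trans hdy.symm)
    subst this
    exact ⟨j, ⟨hd, hj⟩, hjy⟩
  -- B3 for the cusp `t·x̃`: its vertex `t·c` lies in `ℍ̃_i`
  have h0 : L.act i t (L.vtxCusp i x) ∈ L.compH i := hinc i x t (hyp _ (hlev.trans hmeet))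
  -- B3 for the cusp `γt·x̃`: the level-`i` inertia group is the `γ`-conjugate of that of `t·x̃` (`J_i ⊴ Δ^tp_X`)
  have hγt : MulAut.conj ((γ : D.PiTp) * t) • ((D.inertiaTp x).map D.DeltaTp.subtype) ⊓
      (D.levelTp (T.Jhat i)).map D.DeltaTp.subtype ≤ D.deltaTpH.map D.DeltaTp.subtype := by
    intro y hy
    obtain ⟨hy1, ⟨j, hj, hjy⟩⟩ := hy
    have hz : (MulAut.conj (γ : D.PiTp))⁻¹ • y ∈ ID := by
      refine hlev ⟨?_, ?_⟩
      · rw [map_mul, mul_smul] at hy1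
        exact Subgroup.mem_pointwise_smul_iff_inv_smul_mem.mp hy1
      · refine ⟨γ⁻¹ * j * γ, ?_, ?_⟩
        · simpa using (T.levelTp_normal hN i).conj_mem j hj γ⁻¹
        · rw [← hjy, MulAut.smul_def, MulAut.conj_inv_apply]
          simp
    have hy' : y ∈ MulAut.conj (γ : D.PiTp) • ID :=
      Subgroup.mem_pointwise_smul_iff_inv_smul_mem.mpr hz
    exact hc hy'
  have h1 : L.act i ((γ : D.PiTp) * t) (L.vtxCusp i x) ∈ L.compH i := hinc i x _ (hyp _ hγt)
  rw [map_mul, Equiv.Perm.mul_apply] at h1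
  -- `γ` moves a vertex of the block `ℍ̃_i` into `ℍ̃_i`, hence stabilises it; B1 (c) concludes
  exact hstab i γ (hblk i (γ : D.PiTp) ⟨_, h0, h1⟩)

/-- **IUTchII:Cor2.4(i)** (kurims p.71 l.1–3, ONE level, finite-index form, `Π̂_X` side) `levelTarget_sub_of_inputs`
pushed into `Π̂_X` in the consumer's shape: for a subgroup `J ⊆ Π̂_X` with `ι(t I_x t⁻¹) ∩ Ĵ_i ⊆ J ⊆ ι(Δ^tp_{X,ℍ})` and a
tempered geometric `g'` with `J^{g'} ⊆ ι(Δ^tp_{X,ℍ})`, there is `k' ∈ ι(Δ^tp_{X,ℍ})` with `k'⁻¹ g' ∈ Ĵ_i`.  PROVED.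
[claim: Mochizuki2012, status: disputed] -/
theorem levelTarget_sub_hat (hN : T.LevelsNormal) (hinc : L.LevelIncidence) (hblk : L.IsBlock)
    (hstab : L.StabLeDeltaHLevel) (i : T.I) (x : D.Cusp) (t : D.PiTp) (J : Subgroup D.PiHat)
    (hlev : (MulAut.conj t • ((D.inertiaTp x).map D.DeltaTp.subtype)).map D.ιX ⊓ T.Jhat i ≤ J)
    (hmeet : J ≤ (D.deltaTpH.map D.ιΔ).map D.DeltaHat.subtype) {g' : D.PiHat} (hg : g' ∈ D.ιX.range)
    (hgΔ : g' ∈ D.DeltaHat) (hc : MulAut.conj g' • J ≤ (D.deltaTpH.map D.ιΔ).map D.DeltaHat.subtype) :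
    ∃ k' ∈ (D.deltaTpH.map D.ιΔ).map D.DeltaHat.subtype, k'⁻¹ * g' ∈ T.Jhat i := by
  obtain ⟨γ, rfl⟩ := exists_deltaTp_of_mem_range_of_mem_deltaHat hg hgΔ
  set ID : Subgroup D.PiTp := J.comap D.ιX with hID
  have h1 : MulAut.conj t • ((D.inertiaTp x).map D.DeltaTp.subtype) ⊓
      (D.levelTp (T.Jhat i)).map D.DeltaTp.subtype ≤ ID := by
    intro y hy
    refine hlev ⟨⟨y, hy.1, rfl⟩, ?_⟩
    obtain ⟨j, hj, hjy⟩ := hy.2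
    rw [← hjy]
    exact (D.mem_levelTp).mp hj
  have h2 : ID ≤ D.deltaTpH.map D.DeltaTp.subtype := fun y hy => (D.mem_deltaTpH_map_iff y).mpr (hmeet hy)
  have h3 : MulAut.conj (γ : D.PiTp) • ID ≤ D.deltaTpH.map D.DeltaTp.subtype := by
    intro y hy
    refine (D.mem_deltaTpH_map_iff y).mpr (hc ?_)
    rw [Subgroup.mem_pointwise_smul_iff_inv_smul_mem] at hy ⊢
    have hy' : D.ιX ((MulAut.conj (γ : D.PiTp))⁻¹ • y) ∈ J := hy
    simpa [MulAut.smul_def, MulAut.conj_inv_apply, map_mul, map_inv] using hy'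
  obtain ⟨k, hk, hj⟩ := L.levelTarget_sub_of_inputs hN hinc hblk hstab i x t ID h1 h2 γ h3
  refine ⟨D.ιX (k : D.PiTp), ⟨D.ιΔ k, ⟨k, hk, rfl⟩, rfl⟩, ?_⟩
  rw [← map_inv, ← map_mul]
  exact (D.mem_levelTp).mp hj

end SubgraphLevelData

end Prop24Tower

end StableCurveTemperedData

end Literature.IUT.HodgeTheaters

/-! ## § 2. The binder (B) `h23vi` from the level data, through the agreement (`Π̂^cor_v` side) -/

namespace Literature.IUT.HodgeArakelov

open Literature.IUT.HodgeTheaters Topology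
open Literature.AnabelianGeometry.SemiGraphs (IsProSigma)
open scoped Pointwise

namespace PlusMinusTower

namespace StableCurveAgreement

variable {S : BadPlaceSetting.{u}} {P : TopGroup.{u}} {T : TemperedCoverings S P}
  {W : PlusMinusTower T} {C : CuspidalInertiaData W} {D : StableCurveTemperedData.{u}}

/-- **IUTchII:Cor2.4(i)** (kurims p.70 l.−2 – p.71 l.3) **The open-subgroup step (B) for a cuspidal inertia group
`I_t ⊆ Δ_{v□}` of `Π_v`, from the [IUTchI] §2 level statements.**  HYPOTHESES (all named, none asserted): the B13
agreement `A` and the `Δ`-level `ℍ`-dictionary `Dic` of the target `Π_{v□}`; a tower of levels `Ĵ_i ⊆ Π̂_{X_v}` with level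
subgraph data and the predicates `LevelsNormal`, B3 `LevelIncidence`, `IsBlock`, B1 (c) `StabLeDeltaHLevel`
(abc-iut-L5-t11); the levels shrink to `1` (`hbasis'`) and lie inside `Π̂_v` (`hlevV`), with `Π^±_v ∩ Π̂_v ⊆ Π_v`
(`hinf`); [IUTchII] Def 2.3 (ii)′ (`hrel'`); and the printed hypotheses on `I_t` (`hI`, `hIΔ`).  CONCLUSION: for
`γ' ∈ Δ^±_v`, `I^{γ'}_t ⊆ Π^±_{v□} ⟹ γ' ∈` the closure of `Δ^±_{v□}` — the (B) binder of `cor24_i_of_inputs_inc`.  PROVED: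
at level `i`, `J := ê(I_t ∩ Π̂^±_v)` is squeezed between `ι(t I_x t⁻¹) ∩ Ĵ_i` (levels inside `Π̂_v`; `I_t = I' ∩ Π_v`,
`ê(I') = ι(t I_x t⁻¹)` by `inertia_iff`) and `ι(Δ^tp_{X,ℍ})` (dictionary), `J^{ê γ'} ⊆ ι(Δ^tp_{X,ℍ})` (dictionary, all in
`Δ̂^cor_v`), so `levelTarget_sub_hat` gives `ê γ' ∈ ι(Δ^tp_{X,ℍ})·Ĵ_i`, pulled back to `γ' ∈ Δ^±_{v□}·ê⁻¹(Ĵ_i)`; then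
`h23vi_of_levelwise`. [claim: Mochizuki2012, status: disputed] -/
theorem h23vi_of_subgraphLevelData (A : StableCurveAgreement W C D) {H : Subgroup P}
    (Dic : A.SubgraphDictionary H) (Tw : D.Prop24Tower) (Lv : Tw.SubgraphLevelData) (hN : Tw.LevelsNormal)
    (hinc : Lv.LevelIncidence) (hblk : Lv.IsBlock) (hstab : Lv.StabLeDeltaHLevel)
    (hbasis' : ∀ O ∈ 𝓝 (1 : D.PiHat), ∃ i, ((Tw.Jhat i : Subgroup D.PiHat) : Set D.PiHat) ⊆ O)
    (hlevV : ∀ i, Tw.Jhat i ≤ (W.hat.subgroupOf W.pmHat).map A.eHat.toMonoidHom)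
    (hinf : W.piPM ⊓ W.hat ≤ W.piV) (hrel' : Def23_ii' C W.piV W.piPM) {I : Subgroup W.Corhat}
    (hI : C.IsCuspidalInertia W.piV I) (hIΔ : I ≤ W.deltaBox H) :
    ∀ γ' : W.Corhat, γ' ∈ W.piPM ⊓ W.aug.ker →
      I.map (MulAut.conj γ').toMonoidHom ≤ W.pmBox H → γ' ∈ closure (W.deltaPmBox H : Set W.Corhat) := by
  -- `I_t = I' ∩ Π_v` for a cuspidal inertia group `I'` of `Π^±_v`, and `ê(I') = ι(t I_x t⁻¹)`
  obtain ⟨I', hI', -, hII'⟩ := (hrel'.2.1 I).mp hI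
  obtain ⟨hI'pm, x, t, hK⟩ := (A.inertia_iff I').mp hI'
  refine W.h23vi_of_levelwise H I (fun i => ((Tw.Jhat i).comap A.eHat.toMonoidHom).map W.pmHat.subtype)
    (A.levels_hbasis_of_piHat Dic.isHomeomorph Tw.Jhat hbasis') ?_
  intro i γ' hγ' hc
  obtain ⟨hγ'pm', hγ'ker⟩ := Subgroup.mem_inf.mp hγ'
  have hγ'pm : γ' ∈ W.pmHat := W.emb_le_pmHat hγ'pm'
  set g' : D.PiHat := A.eHat ⟨γ', hγ'pm⟩ with hg'
  have hg'tp : g' ∈ D.ιX.range := (A.mem_piPM_iff ⟨γ', hγ'pm⟩).mp hγ'pm'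
  have hg'Δ : g' ∈ D.DeltaHat := (A.mem_ker_iff ⟨γ', hγ'pm⟩).mp hγ'ker
  set J : Subgroup D.PiHat := (I.subgroupOf W.pmHat).map A.eHat.toMonoidHom with hJ
  -- the dictionary on elements: `Δ^±_{v□} ∋ q ↦ ê q ∈ ι(Δ^tp_{X,ℍ})`
  have dic : ∀ q : W.pmHat, (q : W.Corhat) ∈ W.deltaPmBox H →
      A.eHat q ∈ (D.deltaTpH.map D.ιΔ).map D.DeltaHat.subtype := by
    intro q hq
    rw [← Dic.deltaPmBox_eq]
    exact ⟨q, Subgroup.mem_subgroupOf.mpr hq, rfl⟩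
  have hIΔ' : I ≤ W.deltaPmBox H := hIΔ.trans (W.deltaBox_le_deltaPmBox H)
  -- (1) the level-`i` inertia group of the cusp `t·x̃` lies in `J` (levels inside `Π̂_v`, `Π^±_v ∩ Π̂_v ⊆ Π_v`)
  have h1 : (MulAut.conj t • ((D.inertiaTp x).map D.DeltaTp.subtype)).map D.ιX ⊓ Tw.Jhat i ≤ J := by
    rintro y ⟨hy1, hy2⟩
    rw [← hK] at hy1
    obtain ⟨q, hq, rfl⟩ := hy1
    have hqI' : (q : W.Corhat) ∈ I' := Subgroup.mem_subgroupOf.mp hq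
    obtain ⟨q₁, hq₁, hqq₁⟩ := hlevV i hy2
    rw [MulEquiv.coe_toMonoidHom, A.eHat.apply_eq_iff_eq] at hqq₁
    subst hqq₁
    have hqV : (q₁ : W.Corhat) ∈ W.piV := hinf ⟨hI'pm hqI', Subgroup.mem_subgroupOf.mp hq₁⟩
    refine ⟨q₁, Subgroup.mem_subgroupOf.mpr ?_, rfl⟩
    rw [hII']
    exact ⟨hqI', hqV⟩
  -- (2) `J ⊆ ι(Δ^tp_{X,ℍ})` (`I_t ⊆ Δ_{v□} ⊆ Δ^±_{v□}`)
  have h2 : J ≤ (D.deltaTpH.map D.ιΔ).map D.DeltaHat.subtype := by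
    rintro _ ⟨q, hq, rfl⟩
    exact dic q (hIΔ' (Subgroup.mem_subgroupOf.mp hq))
  -- (3) `J^{g'} ⊆ ι(Δ^tp_{X,ℍ})` (from `I^{γ'} ⊆ Π^±_{v□}`, everything inside `Δ̂^cor_v`)
  have hcs : MulAut.conj γ' • I ≤ W.pmBox H := by rw [← map_conj_eq_smul]; exact hc
  have h3 : MulAut.conj g' • J ≤ (D.deltaTpH.map D.ιΔ).map D.DeltaHat.subtype := by
    rw [hJ, hg', ← map_subgroupOf_conj A.eHat I hγ'pm]
    rintro _ ⟨q, hq, rfl⟩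
    have hq' : (q : W.Corhat) ∈ MulAut.conj γ' • I := Subgroup.mem_subgroupOf.mp hq
    refine dic q (Subgroup.mem_inf.mpr ⟨hcs hq', ?_⟩)
    have hz : (MulAut.conj γ')⁻¹ • (q : W.Corhat) ∈ W.aug.ker :=
      (Subgroup.mem_inf.mp (hIΔ' (Subgroup.mem_pointwise_smul_iff_inv_smul_mem.mp hq'))).2
    rw [MulAut.smul_def, MulAut.conj_inv_apply] at hz
    have e : (q : W.Corhat) = γ' * (γ'⁻¹ * q * γ') * γ'⁻¹ := by group
    rw [e]
    exact W.aug.ker.mul_mem (W.aug.ker.mul_mem hγ'ker hz) (W.aug.ker.inv_mem hγ'ker)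
  -- the per-level statement, then pulled back along `ê`
  obtain ⟨k', hk', hkU⟩ := Lv.levelTarget_sub_hat hN hinc hblk hstab i x t J h1 h2 hg'tp hg'Δ h3
  rw [← Dic.deltaPmBox_eq] at hk'
  obtain ⟨k₀, hk₀, rfl⟩ := hk'
  have hk₀box : (k₀ : W.Corhat) ∈ W.deltaPmBox H := Subgroup.mem_subgroupOf.mp hk₀
  refine ⟨k₀, hk₀box, ⟨⟨(k₀ : W.Corhat)⁻¹ * γ', W.pmHat.mul_mem (W.pmHat.inv_mem k₀.2) hγ'pm⟩, ?_, rfl⟩⟩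
  change _ ∈ (Tw.Jhat i).comap A.eHat.toMonoidHom
  rw [Subgroup.mem_comap]
  have e1 : A.eHat.toMonoidHom ⟨(k₀ : W.Corhat)⁻¹ * γ', W.pmHat.mul_mem (W.pmHat.inv_mem k₀.2) hγ'pm⟩ =
      (A.eHat k₀)⁻¹ * g' := by
    rw [hg', ← map_inv, ← map_mul]
    rfl
  rw [e1]
  exact hkU

/-- **IUTchII:Cor2.4(i)** (kurims pp.70–71) The same with the levels' shrinking supplied by abc-iut-L5-t11's
`exists_level_subset_of_mem_nhds` (`Π̂_{X_v}` profinite, `Δ̂_{X_v}` closed, levels inside `Δ̂_{X_v}` and cofinal — the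
Prop 2.4 sub-nodes `DeltaHatClosed`, `LevelsInDelta`, `LevelsCofinal`) and the block property by `CompsDisjoint` +
`CompsInvariant` (`isBlock_of_comps`). PROVED. [claim: Mochizuki2012, status: disputed] -/
theorem h23vi_of_subgraphLevelData' [T2Space D.PiHat] [TotallyDisconnectedSpace D.PiHat]
    (A : StableCurveAgreement W C D) {H : Subgroup P}
    (Dic : A.SubgraphDictionary H) (Tw : D.Prop24Tower) (Lv : Tw.SubgraphLevelData) (hN : Tw.LevelsNormal)
    (hinc : Lv.LevelIncidence) (hdisj : Lv.CompsDisjoint) (hinv : Lv.CompsInvariant) (hstab : Lv.StabLeDeltaHLevel)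
    (hΔc : D.DeltaHatClosed) (hΔ : Tw.LevelsInDelta) (hcof : Tw.LevelsCofinal)
    (hlevV : ∀ i, Tw.Jhat i ≤ (W.hat.subgroupOf W.pmHat).map A.eHat.toMonoidHom)
    (hinf : W.piPM ⊓ W.hat ≤ W.piV) (hrel' : Def23_ii' C W.piV W.piPM) {I : Subgroup W.Corhat}
    (hI : C.IsCuspidalInertia W.piV I) (hIΔ : I ≤ W.deltaBox H) :
    ∀ γ' : W.Corhat, γ' ∈ W.piPM ⊓ W.aug.ker →
      I.map (MulAut.conj γ').toMonoidHom ≤ W.pmBox H → γ' ∈ closure (W.deltaPmBox H : Set W.Corhat) :=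
  A.h23vi_of_subgraphLevelData Dic Tw Lv hN hinc (Lv.isBlock_of_comps hdisj hinv) hstab
    (Tw.exists_level_subset_of_mem_nhds hΔc hΔ hcof) hlevV hinf hrel' hI hIΔ

end StableCurveAgreement

end PlusMinusTower

/-! ## § 3. B5: the decls of record from the agreements, with (B) supplied by level data per admissible `Π_{v□}` -/

section AssemblyLevels

open Literature.IUT.HodgeTheaters Topology
open Literature.AnabelianGeometry.SemiGraphs (IsProSigma)

variable {S : BadPlaceSetting.{u}} {P : TopGroup.{u}} {T : TemperedCoverings S P}
  {D : EtaleThetaData S.toThetaSetting P} {Dsc : StableCurveTemperedData.{u}}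
  (Dec : SubgraphDecomposition S T D) (W : PlusMinusTower T) (C : CuspidalInertiaData W)
  {L : LabCuspStructure C} (Ld : LabelledDecomposition Dec L) (I : Subgroup W.Corhat)

/-- **IUTchII:Cor2.4(i)′ — B5 ASSEMBLY** (kurims pp.69–71): the decl of record `Cor24_i' Dec W C Ld I` from the
agreements, with input (B) SUPPLIED by per-`□` [IUTchI] §2 level data.  HYPOTHESES (named, none asserted): the
agreement `A` with [IUTchI] Prop 2.4 (i) (`Prop24i`); [IUTchII] Def 2.3 (ii)′ (`Def23_ii'`); `e : I_x ≃ₜ* Ẑ`;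
`Π^±_v ∩ Π̂_v ⊆ Π_v` (`hinf`); and, for each admissible `Π_{v□}`, `LevelsDic` = some [IUTchI] §2 datum `D'` with an
agreement `A'`, its `Δ`-level `ℍ`-dictionary, Cor 2.3 (ii), (v) (`Cor23ii`, `Cor23v`), a tower of levels with subgraph
level data satisfying `LevelsNormal`, `LevelIncidence`, `IsBlock`, `StabLeDeltaHLevel`, shrinking to `1` and inside
`Π̂_v`.  CONCLUSION: `Cor24_i'`.  PROVED — node `IUTchII:Cor2.4(i)` modulo NAMED [IUTchI] §2 predicates and the
dictionaries (no anonymous (B) binder left). [claim: Mochizuki2012, status: disputed] -/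
theorem cor24_i'_of_levels_of_equiv_zHat (A : W.StableCurveAgreement C Dsc) (h24i : Dsc.Prop24i)
    (hrel' : Def23_ii' C W.piV W.piPM) (e : ∀ x : Dsc.Cusp, ↥(Dsc.inertiaTp x) ≃ₜ* HodgeTheaters.ZHat)
    (hinf : W.piPM ⊓ W.hat ≤ W.piV)
    (LevelsDic : ∀ H : Subgroup P, Cor24_family Dec Ld H →
      ∃ (D' : StableCurveTemperedData.{u}) (A' : W.StableCurveAgreement C D') (_ : A'.SubgraphDictionary H)
        (_ : D'.Cor23ii) (_ : D'.Cor23v) (Tw : D'.Prop24Tower) (Lv : Tw.SubgraphLevelData),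
        Tw.LevelsNormal ∧ Lv.LevelIncidence ∧ Lv.IsBlock ∧ Lv.StabLeDeltaHLevel ∧
        (∀ O ∈ 𝓝 (1 : D'.PiHat), ∃ i, ((Tw.Jhat i : Subgroup D'.PiHat) : Set D'.PiHat) ⊆ O) ∧
        (∀ i, Tw.Jhat i ≤ (W.hat.subgroupOf W.pmHat).map A'.eHat.toMonoidHom)) :
    Literature.IUT.HodgeArakelov.Cor24_i' Dec W C Ld I :=
  cor24_i'_of_agreements_of_equiv_zHat_inc Dec W C Ld I A h24i hrel' e
    (fun H hH => by
      obtain ⟨D', A', hDic, h23ii, h23vD, -⟩ := LevelsDic H hH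
      exact ⟨D', A', hDic, h23ii, h23vD⟩)
    (fun H hH hI hIΔ => by
      obtain ⟨D', A', hDic, -, -, Tw, Lv, hN, hinc, hblk, hstab, hbasis', hlevV⟩ := LevelsDic H hH
      exact A'.h23vi_of_subgraphLevelData hDic Tw Lv hN hinc hblk hstab hbasis' hlevV hinf hrel' hI hIΔ)

/-- **IUTchII:Cor2.4(ii)(iii)′ — B5 ASSEMBLY** (kurims p.70): the decl of record `Cor24_ii_iii' W C H` for an admissible
`Π_{v□}` from the agreements, with input (B) SUPPLIED by per-`□'` level data (`LevelsDic`, as in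
`cor24_i'_of_levels_of_equiv_zHat`); the other inputs as in `cor24_ii_iii'_of_agreements_of_equiv_zHat_inc`: `A` over the
target `□`'s datum with `Prop24i`, `Cor23Hyp`, `Cor23iii` and the `Π`-level entry `hBox`; `Def23_ii'`, `e`; `hinf`; (E)
`hcap`; (a.2) `hYdd` — ALL HYPOTHESES.  PROVED. [claim: Mochizuki2012, status: disputed] -/
theorem cor24_ii_iii'_of_levels_of_equiv_zHat {H : Subgroup P} (hH : Cor24_family Dec Ld H)
    (A : W.StableCurveAgreement C Dsc) (h24i : Dsc.Prop24i) (hHyp : Dsc.Cor23Hyp) (h23iii : Dsc.Cor23iii)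
    (hrel' : Def23_ii' C W.piV W.piPM) (e : ∀ x : Dsc.Cusp, ↥(Dsc.inertiaTp x) ≃ₜ* HodgeTheaters.ZHat)
    (hinf : W.piPM ⊓ W.hat ≤ W.piV)
    (LevelsDic : ∀ H' : Subgroup P, Cor24_family Dec Ld H' →
      ∃ (D' : StableCurveTemperedData.{u}) (A' : W.StableCurveAgreement C D') (_ : A'.SubgraphDictionary H')
        (_ : D'.Cor23ii) (_ : D'.Cor23v) (Tw : D'.Prop24Tower) (Lv : Tw.SubgraphLevelData),
        Tw.LevelsNormal ∧ Lv.LevelIncidence ∧ Lv.IsBlock ∧ Lv.StabLeDeltaHLevel ∧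
        (∀ O ∈ 𝓝 (1 : D'.PiHat), ∃ i, ((Tw.Jhat i : Subgroup D'.PiHat) : Set D'.PiHat) ⊆ O) ∧
        (∀ i, Tw.Jhat i ≤ (W.hat.subgroupOf W.pmHat).map A'.eHat.toMonoidHom))
    (hBox : ((W.pmBox H).subgroupOf W.pmHat).map A.eHat.toMonoidHom = Dsc.piTpXH.map Dsc.ιX)
    (hcap : W.pmBox H ⊓ W.piV ≤ W.box H)
    (hYdd : ∀ I : Subgroup W.Corhat, C.IsCuspidalInertia W.piV I → I ≤ W.deltaBox H →
      W.cuspDecomp I 1 ≤ (T.YddL).map (W.emb.comp T.incl)) :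
    Literature.IUT.HodgeArakelov.Cor24_ii_iii' W C H :=
  cor24_ii_iii'_of_inputs
    (fun I _ _ => cor24_i'_of_levels_of_equiv_zHat Dec W C Ld I A h24i hrel' e hinf LevelsDic H hH)
    (A.boxOntoGalois_of_cor23iii hBox hHyp h23iii) hcap hYdd

end AssemblyLevels

end Literature.IUT.HodgeArakelov
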